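import Summits.BirchSwinnertonDyer.BirchSwinnertonDyer.Theorems.KimAtThreeDeepUpperUniformPinned
import Summits.BirchSwinnertonDyer.BirchSwinnertonDyer.Theorems.KimAtThreeDeepUpperLocalLatticeUniform
import Summits.BirchSwinnertonDyer.BirchSwinnertonDyer.Theorems.KimAtThreeDeepUpperRiderOfCompat
import Summits.BirchSwinnertonDyer.BirchSwinnertonDyer.Theorems.KimAtThreeShallowEqDeepZetaBodyScaling
import Summits.BirchSwinnertonDyer.Rank1Residual.GaloisImage.KatoKuriharaValueEmptyLevelSockets
import Summits.BirchSwinnertonDyer.Rank1Residual.GaloisImage.KatoDepletedLValue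
import HarnessLib

/-!
# Route `KimAtThreeKolyvagin` (rung W2): crux `DeepUpperAtThree` (19076) BY NAME from the route's four
# published leaves and ONE «defined-Kato package» (C1ₑₓ) per row; `Λfin`, the (Λ)-clauses, the rider, the
# rationality of Kato's constant and all exponent bookkeeping DERIVED (cell `bsd-addord`, seat w2-c3 gen 7)

HONEST FRAMING: glue/END-type theorems with DISPLAYED hypotheses (no definition, no named fact, no `sorry`); the
conclusions are route decls BY NAME but CONDITIONAL on the displayed package (C1ₑₓ), so NOTHING is closed and
nothing is booked; BSD is not proved by any of this.

## What, and why
Gen 6/7 reduced crux 19076 to the route's four leaves and the uniform package (C1ᵤ)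
(`KimAtThreeDeepUpperUniformPinned`), which still DISPLAYS per row the finite-level functionals `Λfin_j` with the
(Λ)-clauses, acc6's two-exponent rider, and the RATIONALITY of Kato's constant with `v₃(κ) ≥ 1`.  This file
replaces (C1ᵤ) by **(C1ₑₓ)**: per tower row `W`, `v₃ ∣ 3`, lattice-optimal `P` at the conductor, there are Kato's
embeddings `ι`, a REAL `κK ≠ 0`, the abstract value datum `Λ` (as in the tree fact
`Kato2004.exists_eulerSystem_expStar_values`) and an additive `φ : H¹(ℚ_{v₃}, T₃W) → ℚ₃` (the scalar dual
exponential `exp*_ω`, abstract) with: `hker` ([BK90] Prop. 3.8 / Ex. 3.11, lattice form) and `hdual` (Tate duality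
+ [BK90] 3.8, lattice form) — seat kim3 gen 13's displayed texts VERBATIM (`KimAtThreeFineKatoLemmaL`); ONE crude
compatibility clause (X1-int_b) `∃ b, 3^b·(φ(h) ⊗ 1 − Λ_{0,r}(y)) ∈ 3^{j+1}·L_int(m)` for every `T`-lift `h` of
`loc_{v₃} κ₀` with `res κ₀ = Ψ y` (for Kato's `Λ := (exp*_ω ∘ loc_𝔓)_𝔓`: `exp*` commutes with restriction, the two
`T`-classes differ by `3^{j+1}H¹(K_𝔓,T)`, and the CRUDE bound `3·exp*_ω(H¹(K_𝔓,T)) ⊆ 𝒪_{K_𝔓}`, `K_𝔓/ℚ₃`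
unramified — `b = 1`; a READING of Kato §9.4 + [BK90] 3.11, own attribution); and Kato's `ZetaBody` family for
`(ι, κK, Λ)` ([Kato04] (8.1.3), 8.12, 8.5, 9.7, 6.6 (1), 13.3).  DERIVED here, not displayed: `Λfin` at any
local torsion (`KimAtThreeDeepUpperLocalLatticeUniform`), the (Λ)-clauses (kim3's `lambda_clauses_of_interface`),
the normalisation `φ = 3^{λ₀}φ′` at any reduction type (n1011's `range_padicLog_eq_span_zpow`), RIDER₂ for the
`3^a`-scaled datum (`KimAtThreeDeepUpperRiderOfCompat`), **`κK ∈ ℚ`** (§1), `κe = v₃(κ) + a ≥ 1` (w2-c4's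
`zetaBody_smul`) and gen 6's certificate bookkeeping; then gen 6's `deepWitnessFamily_of_zetaBody_of_valueRows_pow`
⟶ w2-c2's pinned engine ⟶ the row ⟶ cruxes 19562 / 19076 BY NAME ⟶ the ROUTE's currency (§3 ★★).
HONEST LIMITS: (C1ₑₓ) is construction-shaped but consists of print-shaped clauses about TWO abstract objects
(`Λ`, `φ`); its `hker`/`hdual` are the SAME two cite items as crux 19560's Kato stratum (to be filed in the
`expStar_ω` currency once `defn-EllipticNeronDeRhamClass` lands); NO SAT₀ structure (`Λ₀`, `M`, unit-trace
element), NO `K_w` object, NO R-κ, NO `Addv`/`c₃`/torsion/Manin binder is displayed; the leaves are cite-only.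
References: [Kato2004Asterisque] (8.1.3), 8.12, 8.5, §9.4, 9.7, 6.6 (1), 13.3; [BlochKato1990] §3; [Kim2022StructureSelmer]
§3.2.3, 3.4/3.10/3.11, Thm. 3.13; [Kim2025RefinedTNC] Thm 1.1; [MazurRubin2004] 4.4.1, App. A; [Sakamoto2024] Thm. 4.4;
[MilneADT2006] I.4.10; [Carayol1986]; [MazurTateTeitelbaum1986Invent] §I.8; memo HOME/w2c3/W2C3-DEFINED-KATO-UNIFORM-g7.md. -/

set_option autoImplicit false
-- the Theorems namespace of a single-conjunct summit repeats the summit name by design (D-0017)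
set_option linter.dupNamespace false

noncomputable section

open scoped NumberField TensorProduct ContRepresentation Classical
open CategoryTheory Field Function Finset IsDedekindDomain NumberField WeierstrassCurve
open Rat.HeightOneSpectrum
open Literature.NumberTheory.GaloisRepresentations Literature.NumberTheory.GaloisCohomology
open Literature.NumberTheory.GaloisRepresentations.DiscreteGaloisModule
open Literature.NumberTheory.EllipticCurves Literature.NumberTheory.EllipticCurves.ModularForms
open Literature.NumberTheory.EllipticCurves.Rank1Residual
open Literature.NumberTheory.EllipticCurves.Kato2004
open Literature.NumberTheory.EllipticCurves.Kato2004.EulerSystemValues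
open Summit.BirchSwinnertonDyer.Rank1Residual.GaloisImage
open Summit.BirchSwinnertonDyer.Rank1Residual.Additive.LocalLog
open Summit.BirchSwinnertonDyer.BirchSwinnertonDyer.Theses.KimAtThreeKolyvagin
open Summit.BirchSwinnertonDyer.BirchSwinnertonDyer.Theorems.KimAtThreeDeepUpperUniformOfFineKato
open Summit.BirchSwinnertonDyer.BirchSwinnertonDyer.Theorems.KimAtThreeDeepUpperNonAdditiveAllOfFineKato
open Summit.BirchSwinnertonDyer.BirchSwinnertonDyer.Theorems.KimAtThreeDeepUpperUniformPinned
open Summit.BirchSwinnertonDyer.BirchSwinnertonDyer.Theorems.KimAtThreeDeepUpperLocalLatticeUniform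
open Summit.BirchSwinnertonDyer.BirchSwinnertonDyer.Theorems.KimAtThreeDeepUpperRiderOfCompat
open Summit.BirchSwinnertonDyer.BirchSwinnertonDyer.Theorems.KimAtThreeShallowEqDeepZetaBodyScaling

namespace Summit.BirchSwinnertonDyer.BirchSwinnertonDyer.Theorems.KimAtThreeDeepUpperOfDefinedKatoUniform

/-! ### §1 Kato's constant is RATIONAL on a row with `[0]⁺_f ≠ 0` (no R-κ hypothesis) -/

section Kappa

variable {W : WeierstrassCurve ℚ} [W.IsElliptic] [W.IsGloballyMinimal]
  [ContinuousSMul ℤ_[3] (W.tateModule 3)] [Module.Free ℤ_[3] (W.tateModule 3)]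
  [Module.Finite ℤ_[3] (W.tateModule 3)] {N : ℕ} [NeZero N]

omit [W.IsGloballyMinimal] in
set_option backward.isDefEq.respectTransparency false in
/-- **Kato's real constant `κ` of `ZetaBody` is RATIONAL** whenever `[0]⁺_f ≠ 0` and the row carries gen 6's
certificate (`E = ∏_{q∣3A}(1 − a_q/q + 𝟙_{q∤N}/q) ≠ 0`, `R⁻ ≠ 0`): at the bottom level `m = 1`, trivial character,
`x_{0,∅} = r₀ ∈ ℚ` with `r₀ = κ · L_{(3A)}(f,1)/Ω⁺_f · R⁻` (`KatoValue.zetaBody_value_level_one`), and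
`L_{(3A)}(f,1)/Ω⁺ = E·[0]⁺ ∈ ℚ` (depletion identity + Birch), so `κ = r₀/(E·[0]⁺·R⁻)`.  Replaces the displayed
R-κ rider on rows of analytic rank `0`. [cite: Kato2004Asterisque, Thm. 9.7 (p. 189), Thm. 6.6 (1) (p. 163) and §6.2 (p. 161)]
[cite: MazurTateTeitelbaum1986Invent, §I.8 (8.6)] -/
theorem exists_ratCast_eq_kappa_of_zetaBody (P : ModularParametrizationData W N)
    {ι : (n : ℕ) → (CyclotomicField n ℚ →+* ℂ)} {κK : ℝ}
    {Λ : ∀ (k' : ℕ) (r : Finset (HeightOneSpectrum (𝓞 ℚ))),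
      H1 (tateRep W 3) (cycSubgroup 3 k' r) →ₗ[ℤ_[3]] ℚ_[3] ⊗[ℚ] CyclotomicField (cycLevel 3 k' r) ℚ}
    {c d a : ℤ} {A : ℕ} [NeZero A]
    {z : ∀ (k' : ℕ) (r : (cyclotomicLevelsRat 3 (badPlaces c d A N)).Ideals),
      H1 (tateRep W 3) ((cyclotomicLevelsRat 3 (badPlaces c d A N)).level k' r.1)}
    {x : ∀ (k' : ℕ) (r : (cyclotomicLevelsRat 3 (badPlaces c d A N)).Ideals),
      CyclotomicField (cycLevel 3 k' r.1) ℚ}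
    (hbody : ZetaBody W 3 P.f ι κK Λ c d a A z x) (h0 : ratPlusSymbol P.f 0 ≠ 0)
    (d' : ℤ) (hcd : Int.gcd (c * d) A = 1) (hdd' : d * d' ≡ 1 [ZMOD (A : ℤ)])
    (aM : ℕ → ℤ) (haM : ∀ q ∈ (3 * A).primeFactors, cuspCoeff P.f q = aM q)
    (hE0 : ∏ q ∈ (3 * A).primeFactors, (1 - (aM q : ℚ) / q + (if q ∣ N then 0 else (1 / q : ℚ))) ≠ 0)
    (hR0 : (c : ℚ) ^ 2 * (d : ℚ) ^ 2 * ratMinusSymbol P.f ((a : ℚ) / A) -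
        (c : ℚ) * (d : ℚ) ^ 2 * ratMinusSymbol P.f ((a * c : ℚ) / A) -
        (c : ℚ) ^ 2 * (d : ℚ) * ratMinusSymbol P.f ((a * d' : ℚ) / A) +
        (c : ℚ) * (d : ℚ) * ratMinusSymbol P.f ((a * c * d' : ℚ) / A) ≠ 0) :
    ∃ u : ℚ, (u : ℝ) = κK := by
  haveI : NeZero (3 * A) := ⟨mul_ne_zero three_ne_zero (NeZero.ne A)⟩
  have hf := P.isNewformOf
  have hQ := hf.coeffField_eq_bot
  -- an entire continuation of the `(3A)`-depleted series at the bottom level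
  obtain ⟨LA, hLA, hLAs⟩ := exists_differentiable_eq_twistedLSeries_holds P.f
    (DirichletCharacter.changeLevel (dvd_mul_right (cycLevel 3 0 ∅) (3 * A))
      (1 : DirichletCharacter ℂ (cycLevel 3 0 ∅)))
  have hL : IsDepletedTwistedL P.f (cycLevel 3 0 ∅) (3 * A) (1 : DirichletCharacter ℂ (cycLevel 3 0 ∅)) LA :=
    ⟨hLA, hLAs⟩
  obtain ⟨r₀, -, -, hr₀⟩ := KatoValue.zetaBody_value_level_one hbody d' hcd hdd' hL
  -- `LA 1 = E · L(f,1) = E · Ω⁺ · [0]⁺`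
  obtain ⟨L₀, hL₀, hL₀s⟩ := KatoValue.exists_continuation_cuspFormLSeries P.f
  have hdepl := DepletedLValue.depletedTwistedL_one_eq_ratCast_prod_mul hf
    (KatoValue.isDepletedTwistedL_one_of_cycLevel hL) hL₀ hL₀s
  have hLf1 := KatoValue.apply_one_eq_plusPeriod_mul_ratPlusSymbol P.f hf.1 hQ hL₀ hL₀s
  have hΩ : (plusPeriod P.f : ℂ) ≠ 0 := by exact_mod_cast (IsNewform0.plusPeriod_pos_holds hf.1 hQ).ne'
  -- the removed Euler factors in gen 6's integer models `aM`
  set E : ℚ := ∏ q ∈ (3 * A).primeFactors, (1 - (aM q : ℚ) / q + (if q ∣ N then 0 else (1 / q : ℚ)))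
    with hEdef
  have hEW : (∏ q ∈ (3 * A).primeFactors,
      (1 - (W.LFunction q : ℚ) / q + if q ∣ N then 0 else (1 : ℚ) / q)) = E := by
    rw [hEdef]
    refine Finset.prod_congr rfl fun q hq => ?_
    have h1 : (W.LFunction q : ℂ) = (aM q : ℂ) := by rw [← hf.2 q, haM q hq]
    have h2 : W.LFunction q = aM q := by exact_mod_cast h1
    rw [h2]
  set R : ℚ := (c : ℚ) ^ 2 * (d : ℚ) ^ 2 * ratMinusSymbol P.f ((a : ℚ) / A) -
      (c : ℚ) * (d : ℚ) ^ 2 * ratMinusSymbol P.f ((a * c : ℚ) / A) -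
      (c : ℚ) ^ 2 * (d : ℚ) * ratMinusSymbol P.f ((a * d' : ℚ) / A) +
      (c : ℚ) * (d : ℚ) * ratMinusSymbol P.f ((a * c * d' : ℚ) / A) with hRdef
  set b₀ : ℚ := ratPlusSymbol P.f 0 with hb₀
  have hq0 : E * b₀ * R ≠ 0 := mul_ne_zero (mul_ne_zero hE0 h0) hR0
  -- `r₀ = κ · (E · b₀ · R)`
  have hr : (r₀ : ℂ) = (κK : ℂ) * ((E * b₀ * R : ℚ) : ℂ) := by
    rw [hr₀, KatoValue.cuspFactor_true_one, ← hRdef, hdepl, hEW, hLf1]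
    push_cast
    field_simp
  refine ⟨r₀ / (E * b₀ * R), ?_⟩
  have hκ : (κK : ℂ) = (((r₀ / (E * b₀ * R) : ℚ) : ℝ) : ℂ) := by
    have hq0' : ((E * b₀ * R : ℚ) : ℂ) ≠ 0 := by exact_mod_cast hq0
    rw [Complex.ofReal_ratCast, Rat.cast_div, hr, mul_div_cancel_right₀ _ hq0']
  exact (Complex.ofReal_injective hκ).symm

end Kappa

/-! ### §2 acc1's port family at EVERY tower row with `[0]⁺ ≠ 0` from the defined-Kato package (C1ₑₓ) -/

section Uniform

variable
  -- (C1ₑₓ) the DEFINED-KATO package, uniform road: per row `(ι, κK, Λ, φ)` with `hker`, `hdual` (kim3's texts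
  -- verbatim), the crude compatibility (X1-int_b) between `Λ_{0,r}` and `φ`, and Kato's `ZetaBody` family
  (hKU : ∀ (W : WeierstrassCurve ℚ) [W.IsElliptic] [W.IsGloballyMinimal]
    [ContinuousSMul ℤ_[3] (W.tateModule 3)] [Module.Free ℤ_[3] (W.tateModule 3)]
    [Module.Finite ℤ_[3] (W.tateModule 3)],
    (∀ m : ℕ, W.HasSurjectiveModNGaloisRep (3 ^ m : ℕ)) →
    ∀ (v₃ : HeightOneSpectrum (𝓞 ℚ)), ((3 : ℕ) : 𝓞 ℚ) ∈ v₃.asIdeal →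
    ∀ {N : ℕ} [NeZero N] (P : ModularParametrizationData W N), N = W.conductorNorm ℤ →
      (∀ z ∈ P.L.lattice, ∃ w ∈ periodLattice P.f, z = P.c * w) →
      ∃ (ι : (n : ℕ) → (CyclotomicField n ℚ →+* ℂ)) (κK : ℝ)
        (Λ : ∀ (k' : ℕ) (r : Finset (HeightOneSpectrum (𝓞 ℚ))),
          H1 (tateRep W 3) (cycSubgroup 3 k' r) →ₗ[ℤ_[3]] ℚ_[3] ⊗[ℚ] CyclotomicField (cycLevel 3 k' r) ℚ)
        (φ : (tateLocalRep W 3 (Sum.inr v₃)).cohomology 1 →+ ℚ_[3]),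
        κK ≠ 0 ∧
        -- hker: [BK90] Prop. 3.8 / Ex. 3.11 in lattice form (kernel of `exp*_ω` = `H¹_f = E(ℚ₃) ⊗ ℤ₃`)
        (∀ y, φ y = 0 ↔ ∀ j : ℕ, tateLocalMap W 3 j (Sum.inr v₃) y ∈
          W.kummerSelmerStructure (((3 : ℕ) : ℤ) ^ j * ((3 : ℕ) : ℤ)) (Sum.inr v₃)) ∧
        -- hdual: Tate local duality + [BK90] 3.8 in lattice form (`exp*_ω(H¹) = (log_ω E(ℚ₃))^∨`)
        (∀ a : ℚ_[3], (∃ y, φ y = a) ↔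
          ∀ Q : (W.baseChange ℚ_[3]).toAffine.Point, ‖a * padicLog (W.baseChange ℚ_[3]) Q‖ ≤ 1) ∧
        -- (X1-int_b): `Λ_{0,r}` agrees with `φ` modulo `3^{j+1-b}·L_int` on restriction-compatible classes
        (∃ b : ℕ, ∀ (j : ℕ) (r : Finset (HeightOneSpectrum (𝓞 ℚ)))
          (Ψ : H1 (tateRep W 3) (cycSubgroup 3 0 r) →+
            continuousCohomology 1 (subgroupRep
              (W.torsionGaloisModule (((3 : ℕ) : ℤ) ^ j * ((3 : ℕ) : ℤ))).toTopRep (cycSubgroup 3 0 r))),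
          (∀ (φ₁ : contOneCocycles (subgroupRep (tateRep W 3).toTopRep (cycSubgroup 3 0 r)))
              (ψ : contOneCocycles (subgroupRep
                (W.torsionGaloisModule (((3 : ℕ) : ℤ) ^ j * ((3 : ℕ) : ℤ))).toTopRep (cycSubgroup 3 0 r))),
              (∀ g, ((ψ.1 g : geomTorsion W (((3 : ℕ) : ℤ) ^ j * ((3 : ℕ) : ℤ))) : geomPoints W) =
                TateModule.proj 3 (j + 1) (φ₁.1 g)) →
              Ψ (oneCocycleClass _ φ₁) = oneCocycleClass _ ψ) →
          ∀ (y : H1 (tateRep W 3) (cycSubgroup 3 0 r))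
            (κ₀ : galoisCohomology (W.torsionGaloisModule (((3 : ℕ) : ℤ) ^ j * ((3 : ℕ) : ℤ))) 1)
            (h : (tateLocalRep W 3 (Sum.inr v₃)).cohomology 1),
            resSubgroup (W.torsionGaloisModule (((3 : ℕ) : ℤ) ^ j * ((3 : ℕ) : ℤ))).toTopRep
                (cycSubgroup 3 0 r) 1 κ₀ = Ψ y →
            galoisCohomology.localization (W.torsionGaloisModule (((3 : ℕ) : ℤ) ^ j * ((3 : ℕ) : ℤ)))
                (Sum.inr v₃) 1 κ₀ = tateLocalMap W 3 j (Sum.inr v₃) h →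
            ∃ l ∈ cycIntLattice 3 (cycLevel 3 0 r),
              (((3 : ℕ) : ℤ_[3]) ^ b) • ((φ h ⊗ₜ[ℚ] (1 : CyclotomicField (cycLevel 3 0 r) ℚ)) - Λ 0 r y) =
                (((3 : ℕ) : ℤ_[3]) ^ (j + 1)) • (l : _)) ∧
        -- Kato's Euler system with its values in the coordinate `Λ`
        ∀ (c d a : ℤ) (A : ℕ), 0 < A → Int.gcd c (6 * 3 * A) = 1 → Int.gcd d (6 * 3 * N) = 1 →
          ∃ (z : ∀ (k' : ℕ) (r : (cyclotomicLevelsRat 3 (badPlaces c d A N)).Ideals),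
                H1 (tateRep W 3) ((cyclotomicLevelsRat 3 (badPlaces c d A N)).level k' r.1))
            (x : ∀ (k' : ℕ) (r : (cyclotomicLevelsRat 3 (badPlaces c d A N)).Ideals),
                CyclotomicField (cycLevel 3 k' r.1) ℚ),
            ZetaBody W 3 P.f ι κK Λ c d a A z x)

include hKU

set_option backward.isDefEq.respectTransparency false in
/-- **acc1's displayed port family on EVERY tower row with `[0]⁺_f ≠ 0`, from (C1ₑₓ) alone** (certificate supply
= gen 6's THEOREM `certSupply_uniform`): per row, gen 6's certificate, (C1ₑₓ)'s data and Kato's body for that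
datum, `κK ∈ ℚ` (§1), the normalised `φ′` / `λ₀` / `Λfin` with the (Λ)-clauses
(`exists_finLevelFunctional_clauses_of_dual`), a scaling exponent `a ≥ b, 1 − v₃(κ), −λ₀`, the `3^a`-scaled body
(`zetaBody_smul`), RIDER₂ at `(0, a + λ₀)` (`rider₂_of_compat`), gen 6's certificate bookkeeping, then
`deepWitnessFamily_of_zetaBody_of_valueRows_pow`.  Closes nothing.
[cite: Kato2004Asterisque, (8.1.3) (p. 180), §9.4 (p. 188), Thm. 9.7 (p. 189) and Ex. 13.3 (pp. 224–225)]
[cite: Kim2022StructureSelmer, Thm. 3.13, Lemma 3.4 / 3.10 / 3.11 and §2.2.2] [cite: BlochKato1990, §3 (Prop. 3.8, Ex. 3.11)]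
[cite: MazurRubin2004, App. A Prop. A.2] -/
theorem portFamilyDeep_of_definedKatoUniform :
    ∀ (W : WeierstrassCurve ℚ) [W.IsElliptic] [W.IsGloballyMinimal],
      (∀ m : ℕ, W.HasSurjectiveModNGaloisRep (3 ^ m : ℕ)) →
      ∀ (v₃ : HeightOneSpectrum (𝓞 ℚ)), ((3 : ℕ) : 𝓞 ℚ) ∈ v₃.asIdeal →
      ∀ (η : (q : HeightOneSpectrum (𝓞 ℚ)) → (ZMod (Ideal.absNorm q.asIdeal))ˣ),
        (∀ q, Subgroup.zpowers (η q) = ⊤) →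
      ∀ {N : ℕ} [NeZero N] (P : ModularParametrizationData W N), N = W.conductorNorm ℤ →
        (∀ z ∈ P.L.lattice, ∃ w ∈ periodLattice P.f, z = P.c * w) →
        ratPlusSymbol P.f 0 ≠ 0 →
        ∃ t e : ℕ, ∀ (k : ℕ)
          (Dk : KolyvaginDatum (W.torsionGaloisModule (((3 : ℕ) : ℤ) ^ k * ((3 : ℕ) : ℤ)))),
          Dk.IsCanonicalTauDatumThreeAtWith W (k + t) k η →
          ∃ (κ : Finset (HeightOneSpectrum (𝓞 ℚ)) →
                galoisCohomology (W.torsionGaloisModule (((3 : ℕ) : ℤ) ^ k * ((3 : ℕ) : ℤ))) 1)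
            (Λ : galoisCohomology ((W.torsionGaloisModule (((3 : ℕ) : ℤ) ^ k * ((3 : ℕ) : ℤ))).toLocal
                (Sum.inr v₃)) 1 →+ ZMod (3 ^ (k + 1)))
            (κ' : Finset (HeightOneSpectrum (𝓞 ℚ)) →
                galoisCohomology (W.torsionGaloisModule (((3 : ℕ) : ℤ) ^ k * ((3 : ℕ) : ℤ))) 1),
            KatoKuriharaWitnessAt W k e Dk v₃ P κ Λ κ' := by
  intro W _ _ htow v₃ hv₃ η _hη N _ P hN hlat h0
  haveI : Fact (Nat.Prime 3) := ⟨Nat.prime_three⟩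
  haveI : ContinuousSMul ℤ_[3] (W.tateModule 3) := TateModule.continuousSMul_padicInt
  haveI : Module.Free ℤ_[3] (W.tateModule 3) := W.module_free_tateModule_holds 3
  haveI : Module.Finite ℤ_[3] (W.tateModule 3) := W.module_finite_tateModule_holds 3
  -- gen 6's certificate supply (a THEOREM on every row)
  obtain ⟨c, d, a, A, d', aM, β, hApos, hcA, hdN, hcdA, hcd, hdd', hAN, haM, hE0, hE, hR0, hR⟩ :=
    certSupply_uniform W htow P
  haveI : NeZero A := ⟨hApos.ne'⟩
  -- the defined-Kato package at this row, and Kato's body for the certificate's datum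
  obtain ⟨ι, κK, Λ, φ, hκ0, hker, hdual, ⟨b, hcompat⟩, hz⟩ := hKU W htow v₃ hv₃ P hN hlat
  obtain ⟨z, x, hbody⟩ := hz c d a A hApos hcA hdN
  have hirr : W.HasIrreducibleModPGaloisRep 3 :=
    KimAtThreeKolyvaginPortShared.hasIrreducibleModPGaloisRep_three_of_tower W htow
  obtain ⟨uκ, huκ⟩ := exists_ratCast_eq_kappa_of_zetaBody P hbody h0 d' hcd hdd' aM haM hE0 hR0
  have huκ0 : uκ ≠ 0 := by rintro rfl; exact hκ0 (by rw [← huκ, Rat.cast_zero])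
  obtain ⟨φ', lam, Λfin, hint', hφ, hΛ, hI⟩ :=
    exists_finLevelFunctional_clauses_of_dual W 3 (Sum.inr v₃) φ hker hdual
  obtain ⟨aS, hab, hav, hal⟩ : ∃ aS : ℕ, b ≤ aS ∧ 1 ≤ padicValRat 3 uκ + aS ∧ 0 ≤ (aS : ℤ) + lam := by
    refine ⟨b + (1 - padicValRat 3 uκ).toNat + (-lam).toNat, by omega, ?_, ?_⟩
    · have := Int.self_le_toNat (1 - padicValRat 3 uκ); push_cast; omega
    · have := Int.self_le_toNat (-lam); push_cast; omega
  set e : ℕ := ((aS : ℤ) + lam).toNat with hedef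
  have he : (e : ℤ) = ((0 : ℕ) : ℤ) + aS + lam := by rw [hedef, Int.toNat_of_nonneg hal]; push_cast; ring
  set κe : ℕ := (padicValRat 3 uκ + aS).toNat with hκedef
  have hκe1 : 1 ≤ κe := by
    have : ((κe : ℕ) : ℤ) = padicValRat 3 uκ + aS := by rw [hκedef, Int.toNat_of_nonneg (by omega)]
    omega
  -- the `3^{aS}`-scaled body and its constant
  have hbody' := zetaBody_smul (3 ^ aS) hbody
  have hΛeq : (fun k r => ((3 ^ aS : ℕ) : ℤ_[3]) • Λ k r) =
      (fun k' r => (((3 : ℕ) : ℤ_[3]) ^ aS) • Λ k' r) := by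
    funext k' r; rw [Nat.cast_pow]
  rw [hΛeq] at hbody'
  set uκ' : ℚ := (3 : ℚ) ^ aS * uκ with huκ'def
  have huκ' : (uκ' : ℝ) = ((3 ^ aS : ℕ) : ℝ) * κK := by
    rw [huκ'def, ← huκ]; push_cast; ring
  have hκ0' : ((3 ^ aS : ℕ) : ℝ) * κK ≠ 0 := mul_ne_zero (by positivity) hκ0
  have huκ'0 : uκ' ≠ 0 := mul_ne_zero (by positivity) huκ0
  have hvu : padicValRat 3 uκ' = κe := by
    have hκe : ((κe : ℕ) : ℤ) = padicValRat 3 uκ + aS := by rw [hκedef, Int.toNat_of_nonneg (by omega)]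
    have h3 : padicValRat 3 (3 : ℚ) = 1 := by exact_mod_cast padicValRat.self (p := 3) (by norm_num)
    rw [huκ'def, padicValRat.mul (by positivity) huκ0, padicValRat.pow, h3, hκe]
    ring
  -- RIDER₂ at `(0, e)` for the scaled datum, every depth
  have hfin₂ := fun j => rider₂_of_compat W v₃ Λ φ φ' lam hφ hint' j (Λfin j) (hI j) b (hcompat j) aS 0 e
    hab he
  -- gen 6's certificate bookkeeping for `uκ'` with `v₃(uκ') = κe ≥ 1`
  have hnorm3 : ‖(uκ' : ℚ_[3])‖ = (3 : ℝ) ^ (-(κe : ℤ)) := by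
    rw [Padic.norm_eq_zpow_neg_valuation (by exact_mod_cast huκ'0), Padic.valuation_ratCast, hvu]
    norm_num
  have hnorm3le : ‖(uκ' : ℚ_[3])‖ ≤ 3⁻¹ := by
    rw [hnorm3, show (3 : ℝ)⁻¹ = (3 : ℝ) ^ (-(1 : ℤ)) by norm_num]
    exact zpow_le_zpow_right₀ (by norm_num) (by omega)
  have huκ1 : ‖(uκ' : ℚ_[3])‖ ≤ 1 := hnorm3le.trans (by norm_num)
  have hthird : ∀ m : ℤ, ‖((uκ' * ((m : ℚ) / (3 : ℕ)) : ℚ) : ℚ_[3])‖ ≤ 1 := by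
    intro m
    rw [Rat.cast_mul, norm_mul, Rat.cast_div, norm_div, Rat.cast_intCast, Rat.cast_natCast, Nat.cast_ofNat]
    have h3 : ‖(3 : ℚ_[3])‖ = 3⁻¹ := by
      have := Padic.norm_p (p := 3)
      simpa using this
    rw [h3]
    have hm : ‖((m : ℤ) : ℚ_[3])‖ ≤ 1 := Padic.norm_int_le_one m
    have : ‖((m : ℤ) : ℚ_[3])‖ / 3⁻¹ = 3 * ‖((m : ℤ) : ℚ_[3])‖ := by field_simp
    rw [this]
    nlinarith [norm_nonneg ((m : ℤ) : ℚ_[3]), norm_nonneg (uκ' : ℚ_[3])]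
  have hκa : ‖((uκ' * ((aM 3 : ℚ) / (3 : ℕ)) : ℚ) : ℚ_[3])‖ ≤ 1 := hthird (aM 3)
  have hκ1 : ‖((uκ' * (if 3 ∣ N then 0 else (1 / (3 : ℕ) : ℚ)) : ℚ) : ℚ_[3])‖ ≤ 1 := by
    by_cases h3N : 3 ∣ N
    · rw [if_pos h3N, mul_zero, Rat.cast_zero, norm_zero]; exact zero_le_one
    · rw [if_neg h3N]
      have h := hthird 1
      rw [Int.cast_one] at h
      exact h
  have hκE : padicValRat 3
      (uκ' * ∏ q ∈ (3 * A).primeFactors, (1 - (aM q : ℚ) / q + (if q ∣ N then 0 else (1 / q : ℚ)))) =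
        ((κe + β - 1 : ℕ) : ℤ) := by
    rw [padicValRat.mul huκ'0 hE0, hvu, hE, Nat.cast_sub (hκe1.trans (Nat.le_add_right κe β))]
    push_cast
    ring
  obtain ⟨N₀, hfam⟩ := deepWitnessFamily_of_zetaBody_of_valueRows_pow W P hN hbody' hirr hv₃ Λfin hΛ
    hfin₂ hcdA uκ' huκ' hκ0' huκ1 d' hcd hdd' hAN aM haM hκa hκ1 hE0 hκE hR0 hR
  exact ⟨N₀, 0 + (κe + β - 1), hfam⟩

/-! ### §3 The row, and cruxes 19562 / 19076 BY NAME in the ROUTE's currency -/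

/-- **Crux 19076's conclusion at EVERY tower row with a lattice-optimal datum at the conductor (`3`-integral plus
symbols, `ord(δ̃) = 0`), from [S24] Thm. 4.4 (1)(2) PINNED, GZK, Poitou–Tate and (C1ₑₓ) ALONE** (`[0]⁺ ≠ 0` from
`ord(δ̃) = 0`; port family §2; END = gen 7's `deepUpper_datum_of_poitouTate_of_port_e_deep_pinned` on w2-c2's pinned
engine; no `Finite Ш` binder needed). [cite: Kim2025RefinedTNC, Thm 1.1] [cite: Sakamoto2024, Thm. 4.4 (1)(2) (p. 926)]
[cite: MilneADT2006, Ch. I, Thm. 4.10] [cite: Kato2004Asterisque, (8.1.3), §9.4, Thm. 9.7 and Ex. 13.3] -/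
theorem deepUpper_optimalRow_of_pinnedFacts_of_definedKatoUniform
    (hS24 : Sakamoto2024.kolyvaginSystems_freeRankOne_zmod_three_pow)
    (hS24₂ : Sakamoto2024.kolyvaginSystems_idealOfBasis_eq_fittingIdeal_zmod_three_pow)
    (hGZK : rank_eq_analyticRank_of_analyticRank_le_one)
    (hPT : poitouTate_selmerStructure_duality ℚ)
    (W₀ : WeierstrassCurve ℚ) [W₀.IsElliptic] [W₀.IsGloballyMinimal]
    (htow : ∀ n : ℕ, W₀.HasSurjectiveModNGaloisRep (3 ^ n : ℕ))
    {N : ℕ} [NeZero N] (hN : N = W₀.conductorNorm ℤ) (D₀ : ModularParametrizationData W₀ N)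
    (hopt : ∀ z ∈ D₀.L.lattice, ∃ w ∈ periodLattice D₀.f, z = D₀.c * w)
    (hint : ∀ r : ℚ, ratPlusSymbol D₀.f r ≠ 0 → 0 ≤ padicValRat 3 (ratPlusSymbol D₀.f r))
    (hord : kuriharaVanishingOrder W₀ 3 D₀.f = 0) :
    ∃ d : ℕ, kuriharaPartialDeepInfty W₀ 3 D₀.f = d ∧
      ((padicValNat 3 (Nat.card (AddCommGroup.primaryComponent W₀.sha 3)) + d : ℕ) : ℕ∞) ≤
        kuriharaPartial W₀ 3 D₀.f 0 := by
  haveI : Fact (Nat.Prime 3) := ⟨Nat.prime_three⟩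
  have h0 : ratPlusSymbol D₀.f 0 ≠ 0 :=
    KimAtThreeKolyvaginUnitLevelOneRungs.ratPlusSymbol_zero_ne_zero_of_kuriharaVanishingOrder_eq_zero W₀ 3 D₀.f
      hord
  obtain ⟨v₃, η, hv₃, hη⟩ := KimAtThreeShallowEqDeepSplitGlueNoStub.exists_place_three_and_generators
  obtain ⟨t, e, hPort⟩ := portFamilyDeep_of_definedKatoUniform hKU W₀ htow v₃ hv₃ η hη D₀ hN hopt h0
  exact deepUpper_datum_of_poitouTate_of_port_e_deep_pinned hS24 hS24₂ hGZK hPT W₀ htow D₀ hint hord v₃ hv₃ η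
    hη t e hPort

/-- **Crux `DeepUpperAtThreeOffKatoStratum` (stmt-BirchSwinnertonDyer-19562) BY NAME from the route's leaves
`SakamotoKolyvaginThree` (19558), `RankEqAnalyticRankLeOne` (19921), `PoitouTateSelmerDuality` (19559) and (C1ₑₓ)** —
the row theorem VERBATIM.  Conditional. [cite: Kim2025RefinedTNC, Thm 1.1] [cite: Sakamoto2024, Thm. 4.4 (1)(2) (p. 926)] -/
theorem deepUpperAtThreeOffKatoStratum_of_leaves_of_definedKatoUniform (hSak : SakamotoKolyvaginThree)
    (hGZK : RankEqAnalyticRankLeOne) (hPT : PoitouTateSelmerDuality) :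
    Summit.BirchSwinnertonDyer.BirchSwinnertonDyer.Theses.KimAtThreeKolyvagin.DeepUpperAtThreeOffKatoStratum :=
  fun W₀ _ _ htow _ _ _ hN D₀ hopt _ hint hord _ =>
    deepUpper_optimalRow_of_pinnedFacts_of_definedKatoUniform hKU hSak.1 hSak.2 hGZK hPT W₀ htow hN D₀ hopt
      hint hord

/-- ★ **Crux `DeepUpperAtThree` (stmt-BirchSwinnertonDyer-19076) BY NAME from (C1ₑₓ) and the route's four
registered cite-only children BY NAME** — `SakamotoKolyvaginThree` (19558: [S24] Thm. 4.4 (1) ∧ (2) PINNED),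
`RankEqAnalyticRankLeOne` (19921: GZK), `PoitouTateSelmerDuality` (19559), `CarayolLevelEqConductor` (19467; kim3's
transport to optimal data at the conductor fed the row theorem).  NO S24-DEEP, NO Kato-stratum split, NO PORT″ /
stub / (C3) / SAT₀, NO (DD), NO R-κ, NO `Λfin`/rider displayed.  Conditional; nothing is booked.
[cite: Kim2025RefinedTNC, Thm 1.1] [cite: Sakamoto2024, Thm. 4.4 (1)(2) (p. 926)] [cite: Carayol1986]
[cite: Kato2004Asterisque, §9.4 and Thm. 9.7 (pp. 188–189), Ex. 13.3 (pp. 224–225)] [cite: BlochKato1990, §3 (Prop. 3.8, Ex. 3.11)]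
[cite: MilneADT2006, Ch. I, Thm. 4.10] -/
theorem deepUpperAtThree_of_leaves_of_definedKatoUniform (hSak : SakamotoKolyvaginThree)
    (hGZK : RankEqAnalyticRankLeOne) (hPT : PoitouTateSelmerDuality) (hlev : CarayolLevelEqConductor) :
    Summit.BirchSwinnertonDyer.BirchSwinnertonDyer.Theses.KimAtThreeKolyvagin.DeepUpperAtThree :=
  KimAtThreeKolyvaginIsogenyCruxes.deepUpperAtThree_of_forall_optimalDatum_atConductor hlev
    fun W₀ _ _ htow _ _ _ hN D₀ hopt _ hint hord =>
      deepUpper_optimalRow_of_pinnedFacts_of_definedKatoUniform hKU hSak.1 hSak.2 hGZK hPT W₀ htow hN D₀ hopt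
        hint hord

end Uniform

end Summit.BirchSwinnertonDyer.BirchSwinnertonDyer.Theorems.KimAtThreeDeepUpperOfDefinedKatoUniform

end
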